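import Mathlib.MeasureTheory.Integral.Pi
import Mathlib.MeasureTheory.Measure.Haar.Unique
import Literature.Probability.LatticeModels.PlaneRotatorLiebRivasseauInequality
import Literature.Probability.LatticeModels.PlaneRotatorDuplicatedExpansion
import Literature.Probability.LatticeModels.GinibreCharacterExpansion
import HarnessLib

/-!
# The star two-point function of the plane-rotator model is the two-spin value `I₁(K)/I₀(K)`

E. H. Lieb, *A refinement of Simon's correlation inequality*, Comm. Math. Phys. **77** (1980) 127–135 [Lieb1980],
proof of Theorem 4 (p. 133–134): in the separating inequality (23) with the STAR of `a` as inside system, "it is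
immaterial whether the `B` spins are connected together", and the inside two-point functions are those of "the
two-spin system consisting of `a` and `b` alone", `⟨σ_a·σ_b⟩ = I₁(β)/I₀(β)` (eq. (25): the Fourier coefficients of
`exp[β cos θ]` are `P(m) = I_m(β)`). This file proves exactly that, in the tree's vocabulary
(`PlaneRotator.twoPoint`, `starCoupling` of `PlaneRotatorLiebRivasseauInequality.lean`; `besselI : ℤ → ℝ → ℝ` the
power-series modified Bessel functions of `GinibreCharacterExpansion.lean`):

* `integral_exp_mul_re_eq_besselI_zero`, `integral_re_mul_exp_mul_re_eq_besselI_one` — the Fourier coefficients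
  `∫_{U(1)} e^{K Re z} dz = I₀(K)` and `∫_{U(1)} Re z · e^{K Re z} dz = I₁(K)` for the Haar probability measure
  (the tree's character expansion `hasSum_besselI_mul_zpow` / `integral_reChar_mul_ginibreWeight` with one
  generator, and orthogonality);
* `shearHom x` — the automorphism `θ ↦ (θ_x, (θ_v θ_x⁻¹)_{v ≠ x})` of `U(1)^V` (relative angles to the centre),
  Haar-measure preserving (`measurePreserving_shearHom`, a continuous surjective endomorphism of a compact group);
* `sum_starCoupling_mul_cosDiff` — the star Hamiltonian in relative angles,
  `∑_p star(p) cos = J(x,x) + ∑_{v ≠ x} (J(x,v) + J(v,x)) cos(θ_x − θ_v)`;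
* `twoPoint_starCoupling_eq` — **for `x ≠ b`: `⟨cos(θ_x − θ_b)⟩_{star(x)} = I₁(K_b)/I₀(K_b)`,
  `K_b = J(x,b) + J(b,x)`** (Fubini over the sites after the shear: the other leaves integrate out).

Use: Lieb's Theorem 4 with the Bessel ratio and the layered XY model (`PlaneRotatorLiebCriterion.lean`).
-/

noncomputable section

open MeasureTheory Filter Finset
open scoped Topology BigOperators

namespace Literature.Probability.LatticeModels

namespace PlaneRotator

/-! ### The two Fourier coefficients `I₀`, `I₁` of `e^{K cos θ}` on `U(1)` -/

section CircleBessel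

variable [MeasurableSpace Circle] [BorelSpace Circle]

omit [MeasurableSpace Circle] [BorelSpace Circle] in
/-- `z^m ≡ 1` on `U(1)` iff `m = 0` (test at `e^{iπ/m}`). [folklore] -/
private theorem coe_zpow_eq_one_iff (m : ℤ) : (∀ z : Circle, ((z : ℂ)) ^ m = 1) ↔ m = 0 := by
  constructor
  · intro h
    by_contra hm
    have hz := h (Circle.exp (Real.pi / m))
    rw [Circle.coe_exp, ← Complex.exp_int_mul] at hz
    have hm' : (m : ℂ) ≠ 0 := by exact_mod_cast hm
    have harg : (m : ℂ) * ((Real.pi / m : ℝ) * Complex.I) = Real.pi * Complex.I := by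
      push_cast
      field_simp
    rw [harg, Complex.exp_pi_mul_I] at hz
    norm_num at hz
  · rintro rfl z
    exact zpow_zero _

omit [MeasurableSpace Circle] [BorelSpace Circle] in
/-- The constraint of the one-generator character expansion with trivial observable: `z^{n} ≡ 1` iff `n = 0`.
[folklore] -/
private theorem twistChar_one_eq_one_iff (n : Unit → ℤ) :
    twistChar (fun _ : Unit => ContinuousMonoidHom.id Circle) 1 n = 1 ↔ n = fun _ => 0 := by
  constructor
  · intro h
    have h0 : n () = 0 := by
      refine (coe_zpow_eq_one_iff (n ())).1 fun z => ?_
      have hz := congrArg (fun χ : Circle →ₜ* Circle => ((χ z : Circle) : ℂ)) h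
      simpa [coe_twistChar_apply, Fintype.prod_unique] using hz
    funext u
    exact h0
  · rintro rfl
    refine ContinuousMonoidHom.ext fun z => Circle.ext ?_
    simp

omit [MeasurableSpace Circle] [BorelSpace Circle] in
/-- The constraint of the one-generator character expansion with observable `z`: `z · z^{n} ≡ 1` iff `n = −1`.
[folklore] -/
private theorem twistChar_id_eq_one_iff (n : Unit → ℤ) :
    twistChar (fun _ : Unit => ContinuousMonoidHom.id Circle) (ContinuousMonoidHom.id Circle) n = 1 ↔
      n = fun _ => -1 := by
  constructor
  · intro h
    have h1 : n () + 1 = 0 := by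
      refine (coe_zpow_eq_one_iff (n () + 1)).1 fun z => ?_
      have hz := congrArg (fun χ : Circle →ₜ* Circle => ((χ z : Circle) : ℂ)) h
      simp only [coe_twistChar_apply, Fintype.prod_unique, ContinuousMonoidHom.coe_id, id_eq,
        ContinuousMonoidHom.coe_one, Pi.one_apply, Circle.coe_one] at hz
      rw [zpow_add_one₀ (Circle.coe_ne_zero z), mul_comm]
      exact hz
    funext u
    show n () = -1
    omega
  · rintro rfl
    refine ContinuousMonoidHom.ext fun z => Circle.ext ?_
    simp

/-- **`∫_{U(1)} e^{K Re z} dz = I₀(K)`** (Haar probability measure): the zeroth Fourier coefficient of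
`e^{K cos θ}`. [cite: Lieb1980, eq. (25) (P(m) = I_m(β))] -/
theorem integral_exp_mul_re_eq_besselI_zero (K : ℝ) :
    ∫ z, Real.exp (K * (z : ℂ).re) ∂Measure.haarMeasure (⊤ : TopologicalSpace.PositiveCompacts Circle) =
      besselI 0 K := by
  classical
  have h := integral_ginibreWeight_eq_tsum (Measure.haarMeasure (⊤ : TopologicalSpace.PositiveCompacts Circle))
    (fun _ : Unit => ContinuousMonoidHom.id Circle) (fun _ => K)
  have hw : ∀ z : Circle, ginibreWeight (fun _ : Unit => ContinuousMonoidHom.id Circle) (fun _ => K) z =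
      Real.exp (K * (z : ℂ).re) := fun z => by
    simp [ginibreWeight, ginibreHamiltonian, reChar]
  simp_rw [hw] at h
  rw [h, tsum_eq_single (fun _ : Unit => (0 : ℤ))]
  · rw [if_pos ((twistChar_one_eq_one_iff _).2 rfl), Fintype.prod_unique]
  · intro n hn
    rw [if_neg (fun h' => hn ((twistChar_one_eq_one_iff n).1 h'))]

/-- **`∫_{U(1)} Re z · e^{K Re z} dz = I₁(K)`**: the first Fourier coefficient of `e^{K cos θ}`.
[cite: Lieb1980, eq. (25) (P(m) = I_m(β))] -/
theorem integral_re_mul_exp_mul_re_eq_besselI_one (K : ℝ) :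
    ∫ z, (z : ℂ).re * Real.exp (K * (z : ℂ).re)
        ∂Measure.haarMeasure (⊤ : TopologicalSpace.PositiveCompacts Circle) = besselI 1 K := by
  classical
  have h := integral_reChar_mul_ginibreWeight
    (Measure.haarMeasure (⊤ : TopologicalSpace.PositiveCompacts Circle))
    (fun _ : Unit => ContinuousMonoidHom.id Circle) (fun _ => K) (ContinuousMonoidHom.id Circle)
  have hw : ∀ z : Circle, ginibreWeight (fun _ : Unit => ContinuousMonoidHom.id Circle) (fun _ => K) z =
      Real.exp (K * (z : ℂ).re) := fun z => by
    simp [ginibreWeight, ginibreHamiltonian, reChar]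
  have hr : ∀ z : Circle, reChar (ContinuousMonoidHom.id Circle) z = (z : ℂ).re := fun z => rfl
  simp_rw [hw, hr] at h
  rw [h, tsum_eq_single (fun _ : Unit => (-1 : ℤ))]
  · rw [if_pos ((twistChar_id_eq_one_iff _).2 rfl), Fintype.prod_unique, besselI_neg_index]
  · intro n hn
    rw [if_neg (fun h' => hn ((twistChar_id_eq_one_iff n).1 h'))]

/-- `I₀(K) > 0` as the integral of a positive function. [folklore] -/
private theorem integral_exp_mul_re_pos (K : ℝ) :
    0 < ∫ z, Real.exp (K * (z : ℂ).re) ∂Measure.haarMeasure (⊤ : TopologicalSpace.PositiveCompacts Circle) := by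
  have hc : Continuous fun z : Circle => Real.exp (K * (z : ℂ).re) := by fun_prop
  exact integral_exp_pos (integrable_of_continuous_of_isFiniteMeasure _ hc)

end CircleBessel

/-! ### The star two-point function: the other leaves integrate out -/

section Star

variable {V : Type} [Fintype V] [DecidableEq V]

omit [Fintype V] [DecidableEq V] in
/-- `cos(θ_x − θ_y) = cos(θ_y − θ_x)`. [folklore] -/
private theorem cosDiff_comm (x y : V) (θ : V → Circle) : cosDiff x y θ = cosDiff y x θ := by
  unfold cosDiff
  rw [← Complex.conj_re (starRingEnd ℂ ((θ y : Circle) : ℂ) * (θ x : ℂ)), map_mul, Complex.conj_conj, mul_comm]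

/-- The shear automorphism `θ ↦ (θ_x, (θ_v θ_x⁻¹)_{v ≠ x})` of the torus `U(1)^V` (relative angles to the centre
`x` of a star). [folklore] -/
def shearHom (x : V) : (V → Circle) →* (V → Circle) where
  toFun θ v := if v = x then θ x else θ v * (θ x)⁻¹
  map_one' := by
    funext v
    simp
  map_mul' θ θ' := by
    funext v
    simp only [Pi.mul_apply]
    split_ifs
    · rfl
    · rw [mul_inv]
      exact mul_mul_mul_comm _ _ _ _

omit [Fintype V] in
/-- Pointwise form of the shear. [folklore] -/
private theorem shearHom_apply (x : V) (θ : V → Circle) (v : V) :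
    shearHom x θ v = if v = x then θ x else θ v * (θ x)⁻¹ := rfl

omit [Fintype V] in
/-- The shear is continuous. [folklore] -/
private theorem continuous_shearHom (x : V) : Continuous (shearHom x : (V → Circle) → V → Circle) := by
  refine continuous_pi fun v => ?_
  by_cases hv : v = x
  · simp only [shearHom_apply, hv, if_true]
    exact continuous_apply x
  · simp only [shearHom_apply, hv, if_false]
    exact (continuous_apply v).mul (continuous_apply x).inv

omit [Fintype V] in
/-- The shear is surjective (inverse `η ↦ (η_x, (η_v η_x)_{v ≠ x})`). [folklore] -/
private theorem shearHom_surjective (x : V) : Function.Surjective (shearHom x : (V → Circle) → V → Circle) := by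
  intro η
  refine ⟨fun v => if v = x then η x else η v * η x, funext fun v => ?_⟩
  by_cases hv : v = x
  · simp [shearHom_apply, hv]
  · simp [shearHom_apply, hv]

omit [Fintype V] in
/-- Relative angles to the centre: for `v ≠ x`, `cos(θ_x − θ_v) = Re((shear θ)_v)`. [folklore] -/
private theorem cosDiff_eq_re_shearHom {x v : V} (hv : v ≠ x) (θ : V → Circle) :
    cosDiff x v θ = ((shearHom x θ v : Circle) : ℂ).re := by
  rw [shearHom_apply, if_neg hv, Circle.coe_mul, Circle.coe_inv_eq_conj, cosDiff, mul_comm]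

variable [MeasurableSpace Circle] [BorelSpace Circle]

/-- The shear preserves the Haar measure of the torus (a continuous surjective endomorphism of a compact group).
[folklore] -/
private theorem measurePreserving_shearHom (x : V) : MeasurePreserving (shearHom x) (torusHaar V) (torusHaar V) :=
  MonoidHom.measurePreserving (continuous_shearHom x) (shearHom_surjective x) rfl

/-- Change of variables under the shear for continuous integrands. [folklore] -/
private theorem integral_comp_shearHom (x : V) {F : (V → Circle) → ℝ} (hF : Continuous F) :
    ∫ θ, F (shearHom x θ) ∂torusHaar V = ∫ η, F η ∂torusHaar V := by
  have h := measurePreserving_shearHom (V := V) x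
  calc ∫ θ, F (shearHom x θ) ∂torusHaar V = ∫ η, F η ∂((torusHaar V).map (shearHom x)) :=
        (integral_map h.measurable.aemeasurable hF.aestronglyMeasurable).symm
    _ = ∫ η, F η ∂torusHaar V := by rw [h.map_eq]

omit [MeasurableSpace Circle] [BorelSpace Circle] in
/-- The Hamiltonian of the star of `x` in relative angles: `∑_p star(p) cos = J(x,x) + ∑_{v ≠ x} K_v cos(θ_x − θ_v)`
with `K_v = J(x,v) + J(v,x)`. [cite: Lieb1980, proof of Theorem 4 (the star graph)] -/
theorem sum_starCoupling_mul_cosDiff (J : V × V → ℝ) (x : V) (θ : V → Circle) :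
    ∑ p : V × V, starCoupling J x p * cosDiff p.1 p.2 θ =
      J (x, x) + ∑ v ∈ Finset.univ.erase x, (J (x, v) + J (v, x)) * cosDiff x v θ := by
  classical
  -- split each term according to which endpoint is the centre
  have hsplit : ∀ p : V × V, starCoupling J x p * cosDiff p.1 p.2 θ =
      (if p.1 = x then J (x, p.2) * cosDiff x p.2 θ else 0) +
        (if p.2 = x then (if p.1 = x then 0 else J (p.1, x) * cosDiff x p.1 θ) else 0) := by
    rintro ⟨a, b⟩
    simp only [starCoupling]
    by_cases ha : a = x
    · subst ha
      simp
    · by_cases hb : b = x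
      · subst hb
        simp [ha, cosDiff_comm a b θ]
      · simp [ha, hb]
  have h1 : ∑ p : V × V, (if p.1 = x then J (x, p.2) * cosDiff x p.2 θ else 0) =
      ∑ v, J (x, v) * cosDiff x v θ := by
    rw [Fintype.sum_prod_type]
    have hin : ∀ a : V, ∑ b : V, (if a = x then J (x, b) * cosDiff x b θ else 0) =
        if a = x then ∑ b : V, J (x, b) * cosDiff x b θ else 0 := fun a => by
      split_ifs <;> simp
    simp_rw [hin]
    rw [Finset.sum_ite_eq' Finset.univ x, if_pos (Finset.mem_univ x)]
  have h2 : ∑ p : V × V, (if p.2 = x then (if p.1 = x then 0 else J (p.1, x) * cosDiff x p.1 θ) else 0) =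
      ∑ v ∈ Finset.univ.erase x, J (v, x) * cosDiff x v θ := by
    rw [Fintype.sum_prod_type]
    have hin : ∀ a : V, ∑ b : V, (if b = x then (if a = x then 0 else J (a, x) * cosDiff x a θ) else 0) =
        if a = x then 0 else J (a, x) * cosDiff x a θ := fun a => by
      rw [Finset.sum_ite_eq' Finset.univ x, if_pos (Finset.mem_univ x)]
    simp_rw [hin]
    rw [← Finset.sum_erase_add _ _ (Finset.mem_univ x), if_pos rfl, add_zero]
    exact Finset.sum_congr rfl fun a ha => if_neg (Finset.ne_of_mem_erase ha)
  rw [Finset.sum_congr rfl fun p _ => hsplit p, Finset.sum_add_distrib, h1, h2,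
    ← Finset.add_sum_erase _ _ (Finset.mem_univ x), cosDiff_self, mul_one, add_assoc, ← Finset.sum_add_distrib]
  congr 1
  exact Finset.sum_congr rfl fun v _ => by ring

omit [MeasurableSpace Circle] [BorelSpace Circle] in
/-- The star weight after the shear is a product of one-site weights. [folklore] -/
private theorem exp_sum_eq_prod (J : V × V → ℝ) (x : V) (η : V → Circle) :
    Real.exp (J (x, x) + ∑ v ∈ Finset.univ.erase x, (J (x, v) + J (v, x)) * ((η v : Circle) : ℂ).re) =
      ∏ v, (if v = x then Real.exp (J (x, x)) else Real.exp ((J (x, v) + J (v, x)) * ((η v : Circle) : ℂ).re)) := by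
  rw [← Finset.mul_prod_erase _ _ (Finset.mem_univ x), if_pos rfl, Real.exp_add, Real.exp_sum]
  congr 1
  exact Finset.prod_congr rfl fun v hv => by rw [if_neg (Finset.ne_of_mem_erase hv)]

/-- **The star two-point function is the two-spin value** (Lieb 1980, proof of Theorem 4: in the star of `x` the
leaves other than `b` integrate out): for `x ≠ b` and any couplings `J` on ordered pairs,
`⟨cos(θ_x − θ_b)⟩_{star(x)} = I₁(K)/I₀(K)` with `K = J(x,b) + J(b,x)`.
[cite: Lieb1980, Theorem 4 and eq. (25) (two-spin system, I₁(β)/I₀(β))] -/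
theorem twoPoint_starCoupling_eq (J : V × V → ℝ) {x b : V} (hxb : x ≠ b) :
    twoPoint (starCoupling J x) x b = besselI 1 (J (x, b) + J (b, x)) / besselI 0 (J (x, b) + J (b, x)) := by
  classical
  set K : V → ℝ := fun v => J (x, v) + J (v, x) with hK
  -- one-site weights after the shear
  set g : V → Circle → ℝ := fun v z => if v = x then Real.exp (J (x, x)) else Real.exp (K v * (z : ℂ).re)
    with hg
  set g' : V → Circle → ℝ := fun v z => if v = b then (z : ℂ).re * g v z else g v z with hg'
  have hgc : ∀ v, Continuous (g v) := fun v => by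
    by_cases hv : v = x
    · simp only [hg, hv, if_true]; exact continuous_const
    · simp only [hg, hv, if_false]
      exact Real.continuous_exp.comp (continuous_const.mul (Complex.continuous_re.comp continuous_subtype_val))
  have hg'c : ∀ v, Continuous (g' v) := fun v => by
    by_cases hv : v = b
    · simp only [hg', hv, if_true]
      exact (Complex.continuous_re.comp continuous_subtype_val).mul (hgc b)
    · simp only [hg', hv, if_false]; exact hgc v
  -- the weight and the observable in relative angles
  have hW : ∀ θ : V → Circle, ginibreWeight (pairChars V) (starCoupling J x) θ = ∏ v, g v (shearHom x θ v) := by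
    intro θ
    rw [ginibreWeight_pairChars_eq, sum_starCoupling_mul_cosDiff]
    have : ∑ v ∈ Finset.univ.erase x, (J (x, v) + J (v, x)) * cosDiff x v θ =
        ∑ v ∈ Finset.univ.erase x, (J (x, v) + J (v, x)) * ((shearHom x θ v : Circle) : ℂ).re :=
      Finset.sum_congr rfl fun v hv => by rw [cosDiff_eq_re_shearHom (Finset.ne_of_mem_erase hv)]
    rw [this, exp_sum_eq_prod]
  have hgg' : ∀ η : V → Circle, ∏ v, g' v (η v) = ((η b : Circle) : ℂ).re * ∏ v, g v (η v) := by
    intro η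
    have h1 : ∏ v ∈ Finset.univ.erase b, g' v (η v) = ∏ v ∈ Finset.univ.erase b, g v (η v) :=
      Finset.prod_congr rfl fun v hv => by simp only [hg', if_neg (Finset.ne_of_mem_erase hv)]
    rw [← Finset.mul_prod_erase Finset.univ (fun v => g' v (η v)) (Finset.mem_univ b),
      ← Finset.mul_prod_erase Finset.univ (fun v => g v (η v)) (Finset.mem_univ b), h1]
    simp only [hg', if_pos rfl]
    ring
  have hO : ∀ θ : V → Circle, cosDiff x b θ * ginibreWeight (pairChars V) (starCoupling J x) θ =
      ∏ v, g' v (shearHom x θ v) := by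
    intro θ
    rw [hW, hgg', cosDiff_eq_re_shearHom hxb.symm]
  -- Fubini over the sites
  have hN : ∫ θ, cosDiff x b θ * ginibreWeight (pairChars V) (starCoupling J x) θ ∂torusHaar V =
      ∏ v, ∫ z, g' v z ∂Measure.haarMeasure (⊤ : TopologicalSpace.PositiveCompacts Circle) := by
    simp_rw [hO]
    rw [integral_comp_shearHom x (F := fun η => ∏ v, g' v (η v))
      (continuous_finsetProd _ fun v _ => (hg'c v).comp (continuous_apply v))]
    exact integral_fintype_prod_eq_prod (𝕜 := ℝ) g'
  have hD : ∫ θ, ginibreWeight (pairChars V) (starCoupling J x) θ ∂torusHaar V =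
      ∏ v, ∫ z, g v z ∂Measure.haarMeasure (⊤ : TopologicalSpace.PositiveCompacts Circle) := by
    simp_rw [hW]
    rw [integral_comp_shearHom x (F := fun η => ∏ v, g v (η v))
      (continuous_finsetProd _ fun v _ => (hgc v).comp (continuous_apply v))]
    exact integral_fintype_prod_eq_prod (𝕜 := ℝ) g
  -- all factors but `v = b` cancel
  have hrest : ∏ v ∈ Finset.univ.erase b, ∫ z, g' v z ∂Measure.haarMeasure (⊤ : TopologicalSpace.PositiveCompacts Circle) =
      ∏ v ∈ Finset.univ.erase b, ∫ z, g v z ∂Measure.haarMeasure (⊤ : TopologicalSpace.PositiveCompacts Circle) :=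
    Finset.prod_congr rfl fun v hv => by simp only [hg', if_neg (Finset.ne_of_mem_erase hv)]
  have hpos : ∀ v, 0 < ∫ z, g v z ∂Measure.haarMeasure (⊤ : TopologicalSpace.PositiveCompacts Circle) := by
    intro v
    by_cases hv : v = x
    · simp only [hg, hv, if_true, integral_const, smul_eq_mul]
      simp [Real.exp_pos]
    · simp only [hg, hv, if_false]
      exact integral_exp_mul_re_pos _
  have hrest_ne : ∏ v ∈ Finset.univ.erase b, ∫ z, g v z
      ∂Measure.haarMeasure (⊤ : TopologicalSpace.PositiveCompacts Circle) ≠ 0 :=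
    Finset.prod_ne_zero_iff.2 fun v _ => (hpos v).ne'
  have hgb : ∫ z, g b z ∂Measure.haarMeasure (⊤ : TopologicalSpace.PositiveCompacts Circle) = besselI 0 (K b) := by
    simp only [hg, if_neg hxb.symm]
    exact integral_exp_mul_re_eq_besselI_zero _
  have hg'b : ∫ z, g' b z ∂Measure.haarMeasure (⊤ : TopologicalSpace.PositiveCompacts Circle) = besselI 1 (K b) := by
    simp only [hg', hg, if_true, if_neg hxb.symm]
    exact integral_re_mul_exp_mul_re_eq_besselI_one _
  unfold twoPoint ginibreExpect
  rw [hN, hD, ← Finset.mul_prod_erase _ _ (Finset.mem_univ b),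
    ← Finset.mul_prod_erase Finset.univ (fun v => ∫ z, g v z ∂_) (Finset.mem_univ b), hrest,
    mul_div_mul_right _ _ hrest_ne, hgb, hg'b]

end Star

end PlaneRotator

end Literature.Probability.LatticeModels

end
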